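import Mathlib
import Summits.ResolutionOfSingularities.ResolutionOfSingularities.Theorems.HomologicalConductorSurfaceTerminationCubicTriangleCa
import Summits.ResolutionOfSingularities.ResolutionOfSingularities.Theorems.HomologicalConductorSurfaceTerminationCubicConeExit
import HarnessLib

/-!
# Kill test `SurfaceTermination` (stmt-ResolutionOfSingularities-16488), (R-QH) piece 2 «CUBIC TRIANGLE», part 2:
# the ABSTRACT (E)-pair theorem — a cone with ceiling `ca ⊆ 𝔪²` and two `ca`-quadrics `G₀ ↦ αT²`, `G₁ ↦ 0` on a ruling
# exits at stage `≤ 2` along its weight valuation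

Route `ResolutionOfSingularities/HomologicalConductor` (cell `res-hironaka`, chain W4.4), kill test `SurfaceTermination`
(stmt-16488), residue stub `stub_initialPairOfConstantGenus` ((E)-form); res-L0-w44-plan-1 CHAIN v21 (ρ35e) / v23 standing
offer **(R-QH)**, piece 2, res-D-pv-045 g7. OURS; AI-written, weaker than expert review; nothing here is a statement of the
manuscript under review (Hironaka 2017) and no statement of it is used; no theorem here concludes the kill test or the crux.

This file is `…CubicConeExit` (p545347) with the cubic `f` and the two quadrics ABSTRACTED. SETTING: fields `k ⊆ K`,
`x y z : K`, `f ∈ k[X₀,X₁,X₂]` with **`hker`** (the kernel of `Xᵢ ↦ x, y, z` is `(f)`; `A := k[x,y,z]`), **`hfe`** (`f` vanishes at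
the three coordinate points), a valuation ring `O ∋ k` with `O.valuation x < 1` and the WEIGHT property **`hW`**
(`v(F(x,y,z)) = v(x)ᵈ` for non-vanishing forms `F` of degree `d`). DATA: the S-level CEILING **`hceil`**
(`c̄ ∈ caⁿ(k[X]_𝔪 ⧸ (f)) ⇒ c ∈ 𝔪²`, e.g. part 1's `mem_sq_of_mem_ca_cubicTriangle`) and two forms `G₀, G₁` of degree `2` with
`Ḡᵢ ∈ ca³(k[X]_𝔪 ⧸ (f))` (e.g. Jacobian quadrics), `G₀ ↦ C(α)·T²` (`α ≠ 0`), `G₁ ↦ 0`, `f ↦ 0` along the ruling `(T,0,0)`, and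
`k`-points `v₀, v₁` of the cone with `G₀(v₀) ≠ 0`, `G₁(v₁) ≠ 0`. RESULTS (`T₀ = tower O A 0 = loc O A`, `gᵢ = Gᵢ(x,y,z)`):
* §1 bookkeeping, values at the vertex, local model `exists_locModelEquiv'`, FLOOR transport `aeval_mem_ca_loc_of_mk_mem`,
  CEILING transport `valuation_le_of_mem_ca_loc'` (`c ∈ ca T₀ ⇒ v(c) ≤ v(x)²`), TRANSCENDENCE of `t = g₁ g₀⁻¹` by the
  one-ruling induction (`eq_zero_of_aeval_ratio_eq_zero'`) and `v(P(t)) = 1` for `P ≠ 0`;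
* §2 **`initialPair_of_data`** — `g₀, g₁ ∈ ca T₀`, `g₀ ≠ 0` of MINIMAL value, `g₁ g₀⁻¹` residually transcendental = the residue
  stub's (E) conclusion at `m' = 0`; **`exists_isRegularLocalRing_tower_of_data`** — with `CharP k p`, `IsFractionRing ↥A K`,
  `ringKrullDim ↥A = 2`: `∃ m, IsRegularLocalRing ↥(tower O A m)` (LEMMA E in tower form + res-L0-w44's residual criterion).
Part 3 (`…CubicTriangleExit`) instantiates the data for every cubic through the coordinate triangle with `a₀ ≠ 0`, `a₂ ≠ 0`.
References (mechanism only): S. B. Iyengar, R. Takahashi, IMRN 2016 §2 [`IyengarTakahashi2014`].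
-/

noncomputable section

-- single-problem summit: the doubled namespace component `ResolutionOfSingularities` is forced
set_option linter.dupNamespace false

namespace Summit.ResolutionOfSingularities.ResolutionOfSingularities.Theorems.SurfaceTermination.CubicTriangle

open MvPolynomial
open Literature.RingTheory.CohomologyAnnihilator (cohomologyAnnihilator cohomologyAnnihilatorOfDegree
  ringEquiv_apply_mem_cohomologyAnnihilatorOfDegree mem_cohomologyAnnihilator_iff cohomologyAnnihilatorOfDegree_le)
open Literature.AlgebraicGeometry.Resolution
open Summit.ResolutionOfSingularities.ResolutionOfSingularities.Theorems.NoZeno.Birth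
open Summit.ResolutionOfSingularities.ResolutionOfSingularities.Theorems.HomologicalConductor
open Summit.ResolutionOfSingularities.ResolutionOfSingularities.Theorems.HomologicalConductor.PersistenceKC3Tower

variable {k K : Type} [Field k] [Field K] [Algebra k K]

/-! ## §1 Bookkeeping for a general `f` -/

/-- A polynomial `F` with `F(v) ≠ 0` at a `k`-point `v` with `f(v) = 0` is not a multiple of `f`. [folklore] -/
theorem not_mem_span_of_eval {f F : MvPolynomial (Fin 3) k} (v : Fin 3 → k) (hfv : MvPolynomial.eval v f = 0)
    (hF : MvPolynomial.eval v F ≠ 0) : F ∉ Ideal.span ({f} : Set (MvPolynomial (Fin 3) k)) := by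
  intro h
  obtain ⟨q, rfl⟩ := Ideal.mem_span_singleton'.mp h
  exact hF (by rw [map_mul, hfv, mul_zero])

/-- Ruling `(T,0,0)`: `f ↦ 0`, `G₀ ↦ C(α)T²`, `G₁ ↦ 0` ⇒ `Σᵢ aᵢ G₁ⁱ G₀ⁿ⁻ⁱ ↦ a₀αⁿT²ⁿ`; in `(f)` and `α ≠ 0` ⇒ `a₀ = 0`. [folklore] -/
theorem coeff_zero_eq_zero_of_form_mem_span' {f G₀ G₁ : MvPolynomial (Fin 3) k} {α : k} (hα : α ≠ 0)
    (hrf : MvPolynomial.aeval (R := k) (![Polynomial.X, 0, 0] : Fin 3 → Polynomial k) f = 0)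
    (hr₀ : MvPolynomial.aeval (R := k) (![Polynomial.X, 0, 0] : Fin 3 → Polynomial k) G₀ = Polynomial.C α * Polynomial.X ^ 2)
    (hr₁ : MvPolynomial.aeval (R := k) (![Polynomial.X, 0, 0] : Fin 3 → Polynomial k) G₁ = 0) (P : Polynomial k) (n : ℕ)
    (h : (∑ i ∈ Finset.range (n + 1), C (P.coeff i) * G₁ ^ i * G₀ ^ (n - i)) ∈
      Ideal.span ({f} : Set (MvPolynomial (Fin 3) k))) :
    P.coeff 0 = 0 := by
  obtain ⟨q, hq⟩ := Ideal.mem_span_singleton'.mp h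
  have hev := congrArg (MvPolynomial.aeval (R := k) (![Polynomial.X, 0, 0] : Fin 3 → Polynomial k)) hq
  rw [map_mul, hrf, mul_zero, map_sum] at hev
  simp only [map_mul, map_pow, MvPolynomial.aeval_C, Polynomial.algebraMap_eq, hr₀, hr₁] at hev
  rw [Finset.sum_eq_single 0 (fun i _ hi => by rw [zero_pow hi, mul_zero, zero_mul]) (by simp)] at hev
  simp only [pow_zero, mul_one, Nat.sub_zero, mul_pow, ← map_pow, ← pow_mul, ← mul_assoc, ← map_mul] at hev
  have h2 : (Polynomial.C (P.coeff 0 * α ^ n) * Polynomial.X ^ (2 * n)).coeff (2 * n) = 0 := by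
    rw [← hev, Polynomial.coeff_zero]
  rw [Polynomial.coeff_C_mul_X_pow, if_pos rfl] at h2
  exact (mul_eq_zero.mp h2).resolve_right (pow_ne_zero n hα)

section Cone

variable {f : MvPolynomial (Fin 3) k} {x y z : K}
  (hker : RingHom.ker (MvPolynomial.aeval (R := k) (![x, y, z] : Fin 3 → K)).toRingHom = Ideal.span {f})
include hker

/-- Under `hker`: `F(v) ≠ 0` at a `k`-point `v` with `f(v) = 0` gives `F(x,y,z) ≠ 0`. [folklore] -/
theorem aeval_ne_zero_of_eval' (v : Fin 3 → k) (hfv : MvPolynomial.eval v f = 0) {F : MvPolynomial (Fin 3) k}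
    (hF : MvPolynomial.eval v F ≠ 0) : MvPolynomial.aeval ![x, y, z] F ≠ 0 := by
  intro h0
  have hmem : F ∈ RingHom.ker (MvPolynomial.aeval (R := k) (![x, y, z] : Fin 3 → K)).toRingHom := h0
  rw [hker] at hmem
  exact not_mem_span_of_eval v hfv hF hmem

variable (hfe : ∀ i : Fin 3, MvPolynomial.eval (Pi.single i 1 : Fin 3 → k) f = 0)
include hfe

omit hfe in
/-- `x, y, z ≠ 0` when `f` passes through the three coordinate points (`Xᵢ ∉ (f)`). [folklore] -/
theorem coord_ne_zero' (hfe : ∀ i : Fin 3, MvPolynomial.eval (Pi.single i 1 : Fin 3 → k) f = 0) (i : Fin 3) :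
    (![x, y, z] : Fin 3 → K) i ≠ 0 := by
  have h := aeval_ne_zero_of_eval' hker (Pi.single i 1) (hfe i) (F := X i) (by simp)
  rwa [MvPolynomial.aeval_X] at h

omit hker hfe in
/-- `g₀ⁿ · P(g₁ g₀⁻¹) = (Σᵢ aᵢ G₁ⁱ G₀ⁿ⁻ⁱ)(x,y,z)` for `deg P ≤ n` (clearing denominators). [folklore] -/
theorem aeval_form_eq' {G₀ G₁ : MvPolynomial (Fin 3) k} (hG₀ : MvPolynomial.aeval ![x, y, z] G₀ ≠ 0) (P : Polynomial k)
    (n : ℕ) (hn : P.natDegree ≤ n) :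
    MvPolynomial.aeval ![x, y, z] (∑ i ∈ Finset.range (n + 1), C (P.coeff i) * G₁ ^ i * G₀ ^ (n - i)) =
      (MvPolynomial.aeval ![x, y, z] G₀) ^ n *
        Polynomial.aeval (MvPolynomial.aeval ![x, y, z] G₁ * (MvPolynomial.aeval ![x, y, z] G₀)⁻¹) P := by
  rw [Polynomial.aeval_eq_sum_range' (Nat.lt_succ_of_le hn), map_sum, Finset.mul_sum]
  refine Finset.sum_congr rfl fun i hi => ?_
  have hi' : i ≤ n := Nat.lt_succ_iff.mp (Finset.mem_range.mp hi)
  simp only [map_mul, map_pow, MvPolynomial.aeval_C]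
  rw [Algebra.smul_def, mul_pow, inv_pow, pow_sub₀ _ hG₀ hi']
  ring

omit hfe in
/-- **`t = g₁·g₀⁻¹` is transcendental over `k`** (`P(t) = 0 ⇒ P = 0`): ruling `(T,0,0)` with `f ↦ 0`, `G₀ ↦ C(α)T²` (`α ≠ 0`),
`G₁ ↦ 0`, `g₀, g₁ ≠ 0` ⇒ `a₀ = 0`, `P = X·P'`, induction. [OURS · W4.4 kill test] -/
theorem eq_zero_of_aeval_ratio_eq_zero' {G₀ G₁ : MvPolynomial (Fin 3) k} {α : k} (hα : α ≠ 0)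
    (hrf : MvPolynomial.aeval (R := k) (![Polynomial.X, 0, 0] : Fin 3 → Polynomial k) f = 0)
    (hr₀ : MvPolynomial.aeval (R := k) (![Polynomial.X, 0, 0] : Fin 3 → Polynomial k) G₀ = Polynomial.C α * Polynomial.X ^ 2)
    (hr₁ : MvPolynomial.aeval (R := k) (![Polynomial.X, 0, 0] : Fin 3 → Polynomial k) G₁ = 0)
    (hG₀ : MvPolynomial.aeval ![x, y, z] G₀ ≠ 0) (hG₁ : MvPolynomial.aeval ![x, y, z] G₁ ≠ 0) (n : ℕ) :
    ∀ P : Polynomial k, P.natDegree ≤ n →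
      Polynomial.aeval (MvPolynomial.aeval ![x, y, z] G₁ * (MvPolynomial.aeval ![x, y, z] G₀)⁻¹) P = 0 → P = 0 := by
  have ht0 : MvPolynomial.aeval ![x, y, z] G₁ * (MvPolynomial.aeval ![x, y, z] G₀)⁻¹ ≠ 0 :=
    mul_ne_zero hG₁ (inv_ne_zero hG₀)
  have h0 : ∀ (P : Polynomial k) (n : ℕ), P.natDegree ≤ n →
      Polynomial.aeval (MvPolynomial.aeval ![x, y, z] G₁ * (MvPolynomial.aeval ![x, y, z] G₀)⁻¹) P = 0 →
        P.coeff 0 = 0 := by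
    intro P n hn hP
    apply coeff_zero_eq_zero_of_form_mem_span' hα hrf hr₀ hr₁ P n
    rw [← hker]
    change MvPolynomial.aeval (R := k) (![x, y, z] : Fin 3 → K) _ = 0
    rw [aeval_form_eq' hG₀ P n hn, hP, mul_zero]
  induction n with
  | zero =>
    intro P hn hP; rw [Polynomial.eq_C_of_natDegree_le_zero hn, h0 P 0 hn hP, map_zero]
  | succ n ih =>
    intro P hn hP
    obtain ⟨P', rfl⟩ := Polynomial.X_dvd_iff.mpr (h0 P (n + 1) hn hP)
    by_cases hP' : P' = 0
    · rw [hP', mul_zero]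
    have hdeg : P'.natDegree ≤ n := by have h := Polynomial.natDegree_X_mul hP'; omega
    rw [map_mul, Polynomial.aeval_X, mul_eq_zero] at hP
    rcases hP with h | h
    · exact absurd h ht0
    · rw [ih P' hdeg h, mul_zero]

variable {O : ValuationSubring K}
  (hW : ∀ (d : ℕ) (F : MvPolynomial (Fin 3) k), F.IsHomogeneous d → MvPolynomial.aeval ![x, y, z] F ≠ 0 →
    O.valuation (MvPolynomial.aeval ![x, y, z] F) = O.valuation x ^ d)
include hW

omit hW in
/-- Under the weight property every coordinate has the value of `x`. [folklore] -/
theorem valuation_coord_eq'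
    (hW : ∀ (d : ℕ) (F : MvPolynomial (Fin 3) k), F.IsHomogeneous d → MvPolynomial.aeval ![x, y, z] F ≠ 0 →
      O.valuation (MvPolynomial.aeval ![x, y, z] F) = O.valuation x ^ d)
    (i : Fin 3) : O.valuation ((![x, y, z] : Fin 3 → K) i) = O.valuation x := by
  have h := hW 1 (X i) (isHomogeneous_X k i) (by rw [MvPolynomial.aeval_X]; exact coord_ne_zero' hker hfe i)
  rwa [MvPolynomial.aeval_X, pow_one] at h

omit hker hfe in
/-- `v(G(x,y,z)) = v(x)²` for a non-vanishing quadratic form `G`. [folklore] -/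
theorem valuation_quadric_eq' {G : MvPolynomial (Fin 3) k} (hG : G.IsHomogeneous 2) (hG0 : MvPolynomial.aeval ![x, y, z] G ≠ 0) :
    O.valuation (MvPolynomial.aeval ![x, y, z] G) = O.valuation x ^ 2 :=
  hW 2 G hG hG0

/-- **`v(P(t)) = 1` for every non-zero `P ∈ k[X]`**, `t = g₁·g₀⁻¹`, `G₀, G₁` quadratic forms as in
`eq_zero_of_aeval_ratio_eq_zero'`. [OURS · W4.4 kill test] -/
theorem valuation_aeval_ratio_eq_one' {G₀ G₁ : MvPolynomial (Fin 3) k} (hG₀h : G₀.IsHomogeneous 2)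
    (hG₁h : G₁.IsHomogeneous 2) {α : k} (hα : α ≠ 0)
    (hrf : MvPolynomial.aeval (R := k) (![Polynomial.X, 0, 0] : Fin 3 → Polynomial k) f = 0)
    (hr₀ : MvPolynomial.aeval (R := k) (![Polynomial.X, 0, 0] : Fin 3 → Polynomial k) G₀ = Polynomial.C α * Polynomial.X ^ 2)
    (hr₁ : MvPolynomial.aeval (R := k) (![Polynomial.X, 0, 0] : Fin 3 → Polynomial k) G₁ = 0)
    (hG₀ : MvPolynomial.aeval ![x, y, z] G₀ ≠ 0) (hG₁ : MvPolynomial.aeval ![x, y, z] G₁ ≠ 0) {P : Polynomial k}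
    (hP : P ≠ 0) :
    O.valuation (Polynomial.aeval (MvPolynomial.aeval ![x, y, z] G₁ * (MvPolynomial.aeval ![x, y, z] G₀)⁻¹) P) = 1 := by
  set n := P.natDegree
  have hne : Polynomial.aeval (MvPolynomial.aeval ![x, y, z] G₁ * (MvPolynomial.aeval ![x, y, z] G₀)⁻¹) P ≠ 0 :=
    fun h => hP (eq_zero_of_aeval_ratio_eq_zero' hker hα hrf hr₀ hr₁ hG₀ hG₁ n P le_rfl h)
  have hform : (∑ i ∈ Finset.range (n + 1), C (P.coeff i) * G₁ ^ i * G₀ ^ (n - i)).IsHomogeneous (2 * n) := by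
    refine IsHomogeneous.sum _ _ _ fun i hi => ?_
    have hi' : i ≤ n := Nat.lt_succ_iff.mp (Finset.mem_range.mp hi)
    have hdeg : 0 + 2 * i + 2 * (n - i) = 2 * n := by omega
    exact hdeg ▸ (((isHomogeneous_C _ _).mul (hG₁h.pow i)).mul (hG₀h.pow (n - i)))
  have hne2 : MvPolynomial.aeval ![x, y, z] (∑ i ∈ Finset.range (n + 1), C (P.coeff i) * G₁ ^ i * G₀ ^ (n - i)) ≠ 0 := by
    rw [aeval_form_eq' hG₀ P n le_rfl]
    exact mul_ne_zero (pow_ne_zero _ hG₀) hne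
  have hval := hW (2 * n) _ hform hne2
  rw [aeval_form_eq' hG₀ P n le_rfl, map_mul, map_pow, valuation_quadric_eq' hW hG₀h hG₀, ← pow_mul] at hval
  have h0 : O.valuation x ^ (2 * n) ≠ 0 := pow_ne_zero _ (by rw [Ne, Valuation.zero_iff]; exact coord_ne_zero' hker hfe 0)
  exact mul_left_cancel₀ h0 (by rw [hval, mul_one])

variable (hx : O.valuation x < 1)
include hx

omit hx in
/-- The centre of `O` on `A = k[x,y,z]` is the vertex. [folklore] -/
theorem valuation_coord_lt_one' (hx : O.valuation x < 1) (i : Fin 3) : O.valuation ((![x, y, z] : Fin 3 → K) i) < 1 := by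
  rw [valuation_coord_eq' hker hfe hW]; exact hx

variable (hk : ∀ c : k, algebraMap k K c ∈ O)
include hk

omit hk in
/-- `v(p(x,y,z)) ≤ v(x)` for `p ∈ 𝔪`. [folklore] -/
theorem valuation_aeval_le_of_mem_idealOfVars' (hk : ∀ c : k, algebraMap k K c ∈ O) {p : MvPolynomial (Fin 3) k}
    (hp : p ∈ idealOfVars (Fin 3) k) :
    O.valuation (MvPolynomial.aeval ![x, y, z] p) ≤ O.valuation x := by
  induction hp using Submodule.span_induction with
  | mem p hp =>
    obtain ⟨i, rfl⟩ := hp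
    rw [MvPolynomial.aeval_X, valuation_coord_eq' hker hfe hW i]
  | zero => simp
  | add p q _ _ hp hq => rw [map_add]; exact Valuation.map_add_le _ hp hq
  | smul r p _ hp =>
    rw [smul_eq_mul, map_mul, map_mul]
    have hr : O.valuation (MvPolynomial.aeval ![x, y, z] r) ≤ 1 := (O.valuation_le_one_iff _).mpr
      (KC3Upper.aeval_mem_valuationSubring _ O hk (valuation_coord_lt_one' hker hfe hW hx) r)
    calc O.valuation (MvPolynomial.aeval ![x, y, z] r) * O.valuation (MvPolynomial.aeval ![x, y, z] p)
        ≤ 1 * O.valuation x := mul_le_mul' hr hp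
      _ = O.valuation x := one_mul _

omit hk in
/-- `v(p(x,y,z)) ≤ v(x)²` for `p ∈ 𝔪²`. [folklore] -/
theorem valuation_aeval_le_of_mem_sq' (hk : ∀ c : k, algebraMap k K c ∈ O) {p : MvPolynomial (Fin 3) k}
    (hp : p ∈ idealOfVars (Fin 3) k ^ 2) :
    O.valuation (MvPolynomial.aeval ![x, y, z] p) ≤ O.valuation x ^ 2 := by
  rw [pow_two] at hp
  refine Submodule.mul_induction_on hp (fun a ha b hb => ?_) (fun a b ha hb => ?_)
  · rw [map_mul, map_mul, pow_two]
    exact mul_le_mul' (valuation_aeval_le_of_mem_idealOfVars' hker hfe hW hx hk ha)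
      (valuation_aeval_le_of_mem_idealOfVars' hker hfe hW hx hk hb)
  · rw [map_add]; exact Valuation.map_add_le _ ha hb

/-- **The local model of `T₀`**: `e : ↥(loc O A) ≃+* k[x,y,z]_𝔪 ⧸ (f)` with `e ⟨p(x,y,z), _⟩ = (p/1)‾`. [folklore] -/
theorem exists_locModelEquiv' :
    ∃ e : ↥(loc O (MvPolynomial.aeval (R := k) (![x, y, z] : Fin 3 → K)).range) ≃+*
        (Localization.AtPrime (originIdeal k 3) ⧸ Ideal.span {algebraMap (MvPolynomial (Fin 3) k)
          (Localization.AtPrime (originIdeal k 3)) f}),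
      ∀ (p : MvPolynomial (Fin 3) k)
        (hp : MvPolynomial.aeval ![x, y, z] p ∈ loc O (MvPolynomial.aeval (R := k) (![x, y, z] : Fin 3 → K)).range),
        e ⟨MvPolynomial.aeval ![x, y, z] p, hp⟩ =
          Ideal.Quotient.mk _ (algebraMap (MvPolynomial (Fin 3) k) (Localization.AtPrime (originIdeal k 3)) p) := by
  obtain ⟨e, he⟩ := KC3Upper.exists_locModelEquiv (![x, y, z] : Fin 3 → K) O hk (valuation_coord_lt_one' hker hfe hW hx)
  have hmap : (RingHom.ker (MvPolynomial.aeval (R := k) (![x, y, z] : Fin 3 → K)).toRingHom).map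
      (algebraMap (MvPolynomial (Fin 3) k) (Localization.AtPrime (originIdeal k 3))) =
      Ideal.span {algebraMap (MvPolynomial (Fin 3) k) (Localization.AtPrime (originIdeal k 3)) f} := by
    rw [hker, Ideal.map_span, Set.image_singleton]
  refine ⟨e.trans (Ideal.quotEquivOfEq hmap), fun p hp => ?_⟩
  rw [RingEquiv.trans_apply, he p hp, Ideal.quotEquivOfEq_mk]

/-- **FLOOR TRANSPORT (OURS · W4.4 (R-QH)).** `Ḡ ∈ caⁿ(k[X]_𝔪 ⧸ (f))` ⇒ `G(x,y,z) ∈ ca (loc O A)`. [OURS · W4.4 kill test] -/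
theorem aeval_mem_ca_loc_of_mk_mem (G : MvPolynomial (Fin 3) k) {n : ℕ}
    (hG : Ideal.Quotient.mk (Ideal.span {algebraMap (MvPolynomial (Fin 3) k) (Localization.AtPrime (originIdeal k 3)) f})
      (algebraMap (MvPolynomial (Fin 3) k) (Localization.AtPrime (originIdeal k 3)) G) ∈
      cohomologyAnnihilatorOfDegree (Localization.AtPrime (originIdeal k 3) ⧸
        Ideal.span {algebraMap (MvPolynomial (Fin 3) k) (Localization.AtPrime (originIdeal k 3)) f}) n) :
    MvPolynomial.aeval ![x, y, z] G ∈ ca (loc O (MvPolynomial.aeval (R := k) (![x, y, z] : Fin 3 → K)).range) := by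
  obtain ⟨e, he⟩ := exists_locModelEquiv' hker hfe hW hx hk
  have h3 := ringEquiv_apply_mem_cohomologyAnnihilatorOfDegree
    (S := ↥(loc O (MvPolynomial.aeval (R := k) (![x, y, z] : Fin 3 → K)).range)) e.symm hG
  have hsymm : e.symm (Ideal.Quotient.mk _ (algebraMap (MvPolynomial (Fin 3) k) (Localization.AtPrime (originIdeal k 3)) G)) =
      ⟨MvPolynomial.aeval ![x, y, z] G, CubicCone.aeval_mem_loc O _⟩ := by
    rw [RingEquiv.symm_apply_eq, he]
  rw [hsymm] at h3
  have hu := cohomologyAnnihilatorOfDegree_le n h3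
  have hmem := Set.mem_image_of_mem ((↑) : ↥(loc O (MvPolynomial.aeval (R := k) (![x, y, z] : Fin 3 → K)).range) → K) hu
  rw [Subalgebra.image_coe_cohomologyAnnihilator] at hmem
  exact hmem

/-- **CEILING TRANSPORT (OURS · W4.4 (R-QH)).** S-level ceiling (`c̄ ∈ caⁿ ⇒ c ∈ 𝔪²`) ⇒ every `c ∈ ca (loc O A)` has
`v(c) ≤ v(x)²`. [OURS · W4.4 kill test] -/
theorem valuation_le_of_mem_ca_loc'
    (hceil : ∀ (c : MvPolynomial (Fin 3) k) (n : ℕ),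
      Ideal.Quotient.mk (Ideal.span {algebraMap (MvPolynomial (Fin 3) k) (Localization.AtPrime (originIdeal k 3)) f})
        (algebraMap (MvPolynomial (Fin 3) k) (Localization.AtPrime (originIdeal k 3)) c) ∈
        cohomologyAnnihilatorOfDegree (Localization.AtPrime (originIdeal k 3) ⧸
          Ideal.span {algebraMap (MvPolynomial (Fin 3) k) (Localization.AtPrime (originIdeal k 3)) f}) n →
      c ∈ idealOfVars (Fin 3) k ^ 2)
    {c : K} (hc : c ∈ ca (loc O (MvPolynomial.aeval (R := k) (![x, y, z] : Fin 3 → K)).range)) :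
    O.valuation c ≤ O.valuation x ^ 2 := by
  obtain ⟨e, he⟩ := exists_locModelEquiv' hker hfe hW hx hk
  have himg : c ∈ ((↑) : ↥(loc O (MvPolynomial.aeval (R := k) (![x, y, z] : Fin 3 → K)).range) → K) ''
      (cohomologyAnnihilator ↥(loc O (MvPolynomial.aeval (R := k) (![x, y, z] : Fin 3 → K)).range) :
        Set ↥(loc O (MvPolynomial.aeval (R := k) (![x, y, z] : Fin 3 → K)).range)) := by
    rw [Subalgebra.image_coe_cohomologyAnnihilator]; exact hc
  obtain ⟨u, hu, rfl⟩ := himg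
  obtain ⟨n, hn⟩ := mem_cohomologyAnnihilator_iff.mp hu
  obtain ⟨a, ha, s, hs, hsO, hus⟩ := (mem_loc_iff O _).mp u.2
  obtain ⟨p, rfl⟩ := (AlgHom.mem_range _).mp ha
  obtain ⟨q, rfl⟩ := (AlgHom.mem_range _).mp hs
  by_cases hs0 : MvPolynomial.aeval (![x, y, z] : Fin 3 → K) q = 0
  · rw [hus, hs0, inv_zero, mul_zero, map_zero]; exact zero_le
  have hs1 : O.valuation (MvPolynomial.aeval (![x, y, z] : Fin 3 → K) q) = 1 := by
    apply le_antisymm ((O.valuation_le_one_iff _).mpr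
      (KC3Upper.aeval_mem_valuationSubring _ O hk (valuation_coord_lt_one' hker hfe hW hx) q))
    have h := (O.valuation_le_one_iff _).mpr hsO
    rw [map_inv₀] at h
    exact (inv_le_one₀ (zero_lt_iff.mpr (by rw [Ne, Valuation.zero_iff]; exact hs0))).mp h
  have hprod : u * ⟨_, CubicCone.aeval_mem_loc O q⟩ ∈
      cohomologyAnnihilatorOfDegree ↥(loc O (MvPolynomial.aeval (R := k) (![x, y, z] : Fin 3 → K)).range) n :=
    Ideal.mul_mem_right _ _ hn
  have heq : u * ⟨_, CubicCone.aeval_mem_loc O q⟩ =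
      ⟨MvPolynomial.aeval (![x, y, z] : Fin 3 → K) p, CubicCone.aeval_mem_loc O p⟩ := by
    apply Subtype.ext
    rw [Subalgebra.coe_mul, hus]
    change _ * MvPolynomial.aeval (![x, y, z] : Fin 3 → K) q = _
    rw [mul_assoc, inv_mul_cancel₀ hs0, mul_one]
  rw [heq] at hprod
  have hmodel := ringEquiv_apply_mem_cohomologyAnnihilatorOfDegree
    (S := Localization.AtPrime (originIdeal k 3) ⧸ Ideal.span {algebraMap (MvPolynomial (Fin 3) k)
      (Localization.AtPrime (originIdeal k 3)) f}) e hprod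
  rw [he] at hmodel
  rw [hus, map_mul, map_inv₀, hs1, inv_one, mul_one]
  exact valuation_aeval_le_of_mem_sq' hker hfe hW hx hk (hceil p n hmodel)

/-! ## §2 The abstract (E) pair and the exit -/

/-- **THE (E) INITIAL PAIR FROM DATA (OURS · W4.4 (R-QH)).** `A = k[x,y,z]` a cone `f = 0` through the coordinate triangle
(`hker`, `hfe`), `O ∋ k` a weight valuation ring (`hx`, `hW`); the S-level CEILING `hceil` (`c̄ ∈ caⁿ ⇒ c ∈ 𝔪²`); quadratic forms
`G₀, G₁` with classes in some `caⁿ(k[X]_𝔪 ⧸ (f))`, reading `C(α)T²` (`α ≠ 0`) resp. `0` along the ruling `(T,0,0)` (where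
`f ↦ 0`), non-vanishing at `k`-points `v₀, v₁` of the cone. Then `g₀ = G₀(x,y,z)`, `g₁ = G₁(x,y,z)` lie in `ca (tower O A 0)`,
`g₀ ≠ 0` has MINIMAL value on `ca`, and `g₁ g₀⁻¹` is residually transcendental over `k` — the conclusion of
`stub_initialPairOfConstantGenus` at `m' = 0` for this datum. [OURS · W4.4 kill test] -/
theorem initialPair_of_data
    (hceil : ∀ (c : MvPolynomial (Fin 3) k) (n : ℕ),
      Ideal.Quotient.mk (Ideal.span {algebraMap (MvPolynomial (Fin 3) k) (Localization.AtPrime (originIdeal k 3)) f})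
        (algebraMap (MvPolynomial (Fin 3) k) (Localization.AtPrime (originIdeal k 3)) c) ∈
        cohomologyAnnihilatorOfDegree (Localization.AtPrime (originIdeal k 3) ⧸
          Ideal.span {algebraMap (MvPolynomial (Fin 3) k) (Localization.AtPrime (originIdeal k 3)) f}) n →
      c ∈ idealOfVars (Fin 3) k ^ 2)
    {G₀ G₁ : MvPolynomial (Fin 3) k} (hG₀h : G₀.IsHomogeneous 2) (hG₁h : G₁.IsHomogeneous 2) {n₀ n₁ : ℕ}
    (hG₀ca : Ideal.Quotient.mk (Ideal.span {algebraMap (MvPolynomial (Fin 3) k) (Localization.AtPrime (originIdeal k 3)) f})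
      (algebraMap (MvPolynomial (Fin 3) k) (Localization.AtPrime (originIdeal k 3)) G₀) ∈
      cohomologyAnnihilatorOfDegree (Localization.AtPrime (originIdeal k 3) ⧸
        Ideal.span {algebraMap (MvPolynomial (Fin 3) k) (Localization.AtPrime (originIdeal k 3)) f}) n₀)
    (hG₁ca : Ideal.Quotient.mk (Ideal.span {algebraMap (MvPolynomial (Fin 3) k) (Localization.AtPrime (originIdeal k 3)) f})
      (algebraMap (MvPolynomial (Fin 3) k) (Localization.AtPrime (originIdeal k 3)) G₁) ∈
      cohomologyAnnihilatorOfDegree (Localization.AtPrime (originIdeal k 3) ⧸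
        Ideal.span {algebraMap (MvPolynomial (Fin 3) k) (Localization.AtPrime (originIdeal k 3)) f}) n₁)
    {α : k} (hα : α ≠ 0)
    (hrf : MvPolynomial.aeval (R := k) (![Polynomial.X, 0, 0] : Fin 3 → Polynomial k) f = 0)
    (hr₀ : MvPolynomial.aeval (R := k) (![Polynomial.X, 0, 0] : Fin 3 → Polynomial k) G₀ = Polynomial.C α * Polynomial.X ^ 2)
    (hr₁ : MvPolynomial.aeval (R := k) (![Polynomial.X, 0, 0] : Fin 3 → Polynomial k) G₁ = 0)
    (v₀ v₁ : Fin 3 → k) (hv₀ : MvPolynomial.eval v₀ f = 0) (hv₀' : MvPolynomial.eval v₀ G₀ ≠ 0)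
    (hv₁ : MvPolynomial.eval v₁ f = 0) (hv₁' : MvPolynomial.eval v₁ G₁ ≠ 0) :
    MvPolynomial.aeval ![x, y, z] G₀ ∈ ca (tower O (MvPolynomial.aeval (R := k) (![x, y, z] : Fin 3 → K)).range 0) ∧
    MvPolynomial.aeval ![x, y, z] G₁ ∈ ca (tower O (MvPolynomial.aeval (R := k) (![x, y, z] : Fin 3 → K)).range 0) ∧
    MvPolynomial.aeval ![x, y, z] G₀ ≠ 0 ∧
    (∀ c ∈ ca (tower O (MvPolynomial.aeval (R := k) (![x, y, z] : Fin 3 → K)).range 0),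
      c * (MvPolynomial.aeval ![x, y, z] G₀)⁻¹ ∈ O) ∧
    ∀ P : Polynomial k, P ≠ 0 → ¬ O.valuation (Polynomial.aeval
      (MvPolynomial.aeval ![x, y, z] G₁ * (MvPolynomial.aeval ![x, y, z] G₀)⁻¹) P) < 1 := by
  have hG₀ : MvPolynomial.aeval ![x, y, z] G₀ ≠ 0 := aeval_ne_zero_of_eval' hker v₀ hv₀ hv₀'
  have hG₁ : MvPolynomial.aeval ![x, y, z] G₁ ≠ 0 := aeval_ne_zero_of_eval' hker v₁ hv₁ hv₁'
  rw [tower_zero]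
  refine ⟨aeval_mem_ca_loc_of_mk_mem hker hfe hW hx hk G₀ hG₀ca, aeval_mem_ca_loc_of_mk_mem hker hfe hW hx hk G₁ hG₁ca, hG₀,
    fun c hc => ?_, fun P hP => ?_⟩
  · rw [← O.valuation_le_one_iff, map_mul, map_inv₀, valuation_quadric_eq' hW hG₀h hG₀]
    have h0 : O.valuation x ^ 2 ≠ 0 := pow_ne_zero 2 (by rw [Ne, Valuation.zero_iff]; exact coord_ne_zero' hker hfe 0)
    calc O.valuation c * (O.valuation x ^ 2)⁻¹ ≤ O.valuation x ^ 2 * (O.valuation x ^ 2)⁻¹ :=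
          mul_le_mul' (valuation_le_of_mem_ca_loc' hker hfe hW hx hk hceil hc) le_rfl
      _ = 1 := mul_inv_cancel₀ h0
  · rw [valuation_aeval_ratio_eq_one' hker hfe hW hG₀h hG₁h hα hrf hr₀ hr₁ hG₀ hG₁ hP]; exact lt_irrefl 1

/-- **THE EXIT FROM AN INITIAL PAIR AT STAGE 0 (OURS · W4.4 (R-QH)).** `A = k[x,y,z]` (`hker`, `hfe`), `O` a weight valuation
ring (`hx`, `hW`, `hk`); if `g₀, g₁ ∈ ca (tower O A 0)` with `g₀ ≠ 0` of minimal value and `g₁ g₀⁻¹` residually transcendental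
(e.g. from `initialPair_of_data`), then with the kill test's remaining binders (`p` prime, `CharP k p`, `IsFractionRing ↥A K`,
`ringKrullDim ↥A = 2`): **`∃ m, IsRegularLocalRing ↥(tower O A m)`** (LEMMA E in tower form: `mul_inv_mem_chart`,
`chart_le_loc_nrm_chart`, res-L0-w44's residual criterion). [OURS · W4.4 kill test] -/
theorem exists_isRegularLocalRing_tower_of_initialPair {g₀ g₁ : K}
    (h₀ : g₀ ∈ ca (tower O (MvPolynomial.aeval (R := k) (![x, y, z] : Fin 3 → K)).range 0))
    (h₁ : g₁ ∈ ca (tower O (MvPolynomial.aeval (R := k) (![x, y, z] : Fin 3 → K)).range 0)) (hne : g₀ ≠ 0)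
    (hmin : ∀ c ∈ ca (tower O (MvPolynomial.aeval (R := k) (![x, y, z] : Fin 3 → K)).range 0), c * g₀⁻¹ ∈ O)
    (hval : ∀ P : Polynomial k, P ≠ 0 → ¬ O.valuation (Polynomial.aeval (g₁ * g₀⁻¹) P) < 1)
    (p : ℕ) (hp : p.Prime) [CharP k p]
    (hfr : IsFractionRing ↥(MvPolynomial.aeval (R := k) (![x, y, z] : Fin 3 → K)).range K)
    (hdim : ringKrullDim ↥(MvPolynomial.aeval (R := k) (![x, y, z] : Fin 3 → K)).range = 2) :
    ∃ m : ℕ, IsRegularLocalRing ↥(tower O (MvPolynomial.aeval (R := k) (![x, y, z] : Fin 3 → K)).range m) := by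
  have hA : (MvPolynomial.aeval (R := k) (![x, y, z] : Fin 3 → K)).range.FG :=
    ⟨(Set.finite_range ![x, y, z]).toFinset, by rw [Set.Finite.coe_toFinset, Algebra.adjoin_range_eq_range_aeval]⟩
  have hAO : (MvPolynomial.aeval (R := k) (![x, y, z] : Fin 3 → K)).range.toSubring ≤ O.toSubring := by
    rintro a ⟨q, rfl⟩
    exact KC3Upper.aeval_mem_valuationSubring _ O hk (valuation_coord_lt_one' hker hfe hW hx) q
  have htr : Algebra.trdeg k K ≤ 2 := (Reduction.trdeg_eq_two_of_ringKrullDim_eq_two _ hA hfr hdim).le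
  rw [tower_zero] at h₀ h₁ hmin
  have hsucc : g₁ * g₀⁻¹ ∈ tower O (MvPolynomial.aeval (R := k) (![x, y, z] : Fin 3 → K)).range (0 + 1) := by
    rw [tower_succ, tower_zero]
    exact NoZeno.SandwichCluster.chart_le_loc_nrm_chart O _ (NoZeno.SandwichCluster.mul_inv_mem_chart O _ h₁ h₀ hne hmin)
  exact Regimes.exists_regular_of_residually_transcendental_mem_tower p hp k K O _ hk hA hfr hAO htr hval (0 + 1) hsucc

end Cone

end Summit.ResolutionOfSingularities.ResolutionOfSingularities.Theorems.SurfaceTermination.CubicTriangle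

end
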